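/-
Copyright: lit-balaban Phase-2 proof seat p09 (gen 10).  Statement-level skeleton of a published paper; no proof claims beyond what
the kernel checks below.
-/
import Literature.MathematicalPhysics.QuantumFieldTheory.BalabanImbrieJaffe1984to88.BIJ85LineSumTkBound
import Literature.MathematicalPhysics.QuantumFieldTheory.BalabanImbrieJaffe1984to88.BIJ85Claim73AllTori
import Literature.MathematicalPhysics.QuantumFieldTheory.BalabanImbrieJaffe1984to88.BIJ85Claim73SecondForm

/-!
# [BalabanImbrieJaffe1985] §7.3 p. 326, SECOND PRINTED FORM OF (7.3.2) ON EVERY TWO-DIMENSIONAL TORUS: p11's closed-field index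
`SecClosedIdx 2 K_R K_T 𝓅` IS TOTAL over the actual Sect. 7.3 data with ONE `K_R` and `K_T := K₀·k`, HYPOTHESIS-FREE — the assembly
item (ε) of GAPS G-C1-05 (ADDENDA 7–8 «WHAT REMAINS») for `d = 2`

T. Bałaban, J. Imbrie, A. Jaffe, *Renormalization of the Higgs model: minimizers, propagators and the stability of mean field theory*,
Commun. Math. Phys. **97** (1985) 299–329 [BalabanImbrieJaffe1985].  Row **C1.Eq7.3.1-7.3.2** of the lit-balaban skeleton (owner r15,
referee ref-5); free-target protocol G.5-34(d), TAKING line HOME/STATUS.md 2026-08-22T01:02:26Z (seat p09 gen 10).  v1 = p313000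
ed601f972e91; v1.1 = HONEST SCOPE (ii) corrected (GAPS G-C1-05 ADDENDUM 7 SUPPLEMENT 3), declarations byte-identical.

THE PRINTED TEXT, verbatim (p. 326 [PDF 28]): *"let us assume that for the unit lattice field v, |v(∂p) − 1| ≤ e_k𝓅(e_k), (7.3.1) where
𝓅(e_k) = (1 + ln e_k^{−1})^𝓅. Then the stability estimate can be stated in two forms. For constants γ > 0, α > 0, M < ∞,
⟨φ, Δ_k(u_k)φ⟩ ≥ γ Σ_{b∈T₁^{(k)}} |u_k(b)φ(b₊) − φ(b₋)|² − Me_k^{2−α} Σ_{x∈T₁^{(k)}} |φ(x)|². (7.3.2) The second form of the inequality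
substitutes v_b for u_k(b) in the covariant derivative of φ."*

WHAT THIS FILE PROVES (0 `sorry`, theorems only — proof lane; objects BY NAME, nothing re-declared: p11's `SecClosedIdx` /
`secClosedStabData` / `claim73_second_closed` / `vK` / `norm_toC_lineIter_actualBgU1_sub_le` / `abs_plaqField_le_of_hyp`
(`BIJ85Claim73SecondForm`), p33's `ClosedIdx` / `closedIdx_allTori` (`BIJ85Claim73Closed`, `BIJ85Claim73AllTori`), the gen-9
`exists_KT_linear_allTori` (`BIJ85LineSumTkBound`), p33 g7's `actualBgU1`, p31's `TkF`, r15's `ScalarStabData.Claim73`):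
* §1 **`secClosedIdx_allTori_two`** — for every odd `L > 1`, every `a > 0` (the (7.2.2)/(1.69) mass parameter feeding `K_R`) and every
  exponent `𝓅` there are ONE `K_R ≥ 1` and ONE `K₀ ≥ 0` such that EVERY actual Sect. 7.3 datum on a two-dimensional torus — any `P` with
  `P.d = 2`, `P.L = L` (any volume exponent `m`, any number of steps `K`), any scale `1 ≤ k ≤ m + K`, any coupling `0 < e ≤ 1` with
  `e𝓅(e) ≤ ½`, ANY unit-lattice `U(1)` field `v` — is an index of `SecClosedIdx 2 K_R (K₀·k) 𝓅`: the residual property `hR` from p33's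
  all-tori index (ONE `K_R`, [6I] Prop. 1.2 over all tori inside), the line-sum property `hT` from the gen-9 kernel route (`K_T = K₀·k`,
  valid for ALL unit plaquette fields `g`, closed or not).  NO located hypothesis remains in `d = 2`.
* §2 **`claim73_second_closed_allTori_two`** — hence r15's `Claim73 𝓅` in its SECOND PRINTED FORM holds, for every `k`, for p11's family
  `secClosedStabData a₀` over `SecClosedIdx 2 K_R (K₀·k) 𝓅` (p11's `claim73_second_closed`, constants `γ = ½min(a₀/27, 1/12)`, `α = ½`,
  `M_k = ((4/3)·2⁴((π/2)K_R)² + min(a₀/27,1/12)·2·((π/2)K₀k)²)(1+4𝓅₊)^{2𝓅₊}`), AND that family contains every actual datum of scale `k`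
  on every two-dimensional torus.
* §3 **`norm_lineIter_actualBgU1_sub_vK_le_two`** — the SUBSTITUTION ERROR between the two printed forms on every two-dimensional torus,
  with no index and no closedness regime: under (7.3.1), for every unit bond `c`, `‖u_k(c) − v_c‖ ≤ e_k·K₀·k·(π/2)𝓅(e_k)` (p11's
  `norm_toC_lineIter_actualBgU1_sub_le` + `abs_plaqField_le_of_hyp` + the gen-9 line-sum bound, which needs neither `e𝓅(e) ≤ ½` nor
  closedness of `f^{(k)}`).
HONEST SCOPE.  (i) `d = 2` only (the gen-9 kernel route; in `d ≥ 3` its absolute-value majorant is not even linear in `k` — GAPS G-C1-05,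
p09 gen 10 note).  (ii) `K_T = K₀·k` is LINEAR in the number of scales, so the constant `M_k` of §2 grows like `k²`: this is NOT the
printed claim *"For constants γ > 0, α > 0, M < ∞"* chosen before `k` — the k-UNIFORM `K_T` (GAPS G-C1-05 (γ′), numerically indicated,
ADDENDUM 7) remains the located remainder of the second printed form, and it is NECESSARY: by (4.2.4) p. 310 `e_k = e(L^kε)^{(4−d)/2}`
(`η = L^{−k}`, (2.24)) the coupling grows with `k`, so the factor `k` is NOT absorbed by a power of `ln e_k⁻¹` at the late steps (it is
`N − k`, not `k`, that is `≤ 2ln(e_k⁻¹)/((4−d)ln L)`; GAPS G-C1-05 ADDENDUM 7 SUPPLEMENT 3 withdraws the contrary gen-9 remark).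
(iii) First printed form, `K_R`: p33's `claim73_allTori` (all
`d ≥ 2`, k-uniform) is untouched and not restated.  (iv) `U = 1` real abelian fields, torus, standing range, constants explicit and not
optimised.  Nothing printed is contradicted; no statement weakened; nothing here is summit progress.

statement-level skeleton of published theorems with citation tags; proofs where landed; nothing here is a claim about the Yang–Mills mass gap
-/

open scoped RealInnerProductSpace BigOperators
open Finset Complex

namespace Literature.MathematicalPhysics.QuantumFieldTheory.BalabanImbrieJaffe1984to88.BIJ85SecClosedIdxAllToriTwo

open Literature.MathematicalPhysics.QuantumFieldTheory.Balaban1983to89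
open BIJ88Sect3Statements (U1 toC)
open BIJ85Sect1Model (U1Field plaq)
open BIJ85SmallFieldSplit64 (plaqField)
open BIJ85BlockAveragesTorusK (lineIter)
open BIJ85Ineq732SecondForm (lineSumIter)
open BIJ85Sigma422Eta (eta_pos)
open BIJ85Eq454PlaqResidual (actualBgU1)
open BIJ85Claim73Closed (ClosedIdx)
open BIJ85Claim73SecondForm (SecClosedIdx vK secClosedStabData claim73_second_closed norm_toC_lineIter_actualBgU1_sub_le
  abs_plaqField_le_of_hyp)
open BIJ85Claim73AllTori (closedIdx_allTori)
open BIJ85LineSumTkBound (exists_KT_linear_allTori)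
open BIJ88Eq541Base0 (TkF)
open BIJ85Sect7Statements (ScalarStabData)

noncomputable section

/-! ## §1  The closed-field index of the second printed form is total over all two-dimensional tori, hypothesis-free -/

/-- **`SecClosedIdx 2 K_R (K₀·k) 𝓅` IS TOTAL OVER THE ACTUAL Sect. 7.3 DATA ON EVERY TWO-DIMENSIONAL TORUS, HYPOTHESIS-FREE**: for every odd
`L > 1`, `a > 0` and `𝓅` there are ONE `K_R ≥ 1` (p33's `closedIdx_allTori`: the residual-curvature property on closed unit fields, [6I]
Prop. 1.2 over all tori inside) and ONE `K₀ ≥ 0` (gen 9's `exists_KT_linear_allTori`: the line sums of `T_kg` along unit bonds, all `g`)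
such that every torus `P` with `P.d = 2`, `P.L = L`, every scale `1 ≤ k ≤ m + K`, every `0 < e ≤ 1` with `e𝓅(e) ≤ ½` and every unit
`U(1)` field `v` give an index of p11's `SecClosedIdx 2 K_R (K₀·k) 𝓅`. [cite: BalabanImbrieJaffe1985, (7.3.1)–(7.3.2) p.326] -/
theorem secClosedIdx_allTori_two {L : ℕ} (hL : Odd L ∧ 1 < L) {a : ℝ} (ha : 0 < a) (pexp : ℝ) :
    ∃ KR K₀ : ℝ, 1 ≤ KR ∧ 0 ≤ K₀ ∧ ∀ (P : Params), P.d = 2 → P.L = L → ∀ (k : ℕ), 1 ≤ k → k ≤ P.m + P.K →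
      ∀ (e : ℝ) (he : 0 < e) (he1 : e ≤ 1) (hsmall : e * (1 + Real.log e⁻¹) ^ pexp ≤ 1 / 2) (v : U1Field P k),
        ∃ i : SecClosedIdx 2 KR (K₀ * k) pexp, i.P = P ∧ i.k = k ∧ i.e = e ∧ HEq i.v v := by
  obtain ⟨KR, hKR, hidx⟩ := closedIdx_allTori (d := 2) (L := L) le_rfl ha pexp
  obtain ⟨K₀, hK₀, hT⟩ := exists_KT_linear_allTori hL
  refine ⟨KR, K₀, hKR, hK₀, fun P hPd hPL k hk1 hk e he he1 hsmall v => ?_⟩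
  obtain ⟨i, hP, hk', he', hv⟩ := hidx P hPd hPL k hk1 hk e he he1 hsmall v
  subst hP hk' he'
  exact ⟨{ toClosedIdx := i, hT := fun g _ C hg c => hT i.P hPd hPL i.hd2 i.k i.hk g C hg c }, rfl, rfl, rfl, hv⟩

/-! ## §2  `Claim73 𝓅`, second printed form, on every two-dimensional torus -/

/-- **r15's `Claim73 𝓅` IN ITS SECOND PRINTED FORM ON EVERY TWO-DIMENSIONAL TORUS**: for every odd `L > 1`, `a > 0` (feeding `K_R`),
`a₀ > 0` (the printed `a` of (4.6.4)) and `𝓅` there are ONE `K_R ≥ 1` and ONE `K₀ ≥ 0` such that (a) for every `k`, `Claim73 𝓅` holds for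
p11's second-form family `secClosedStabData a₀` over `SecClosedIdx 2 K_R (K₀·k) 𝓅` (constants `γ = ½min(a₀/27, 1/12)`, `α = ½`,
`M_k = ((4/3)·16·((π/2)K_R)² + min(a₀/27,1/12)·2·((π/2)K₀k)²)(1+4𝓅₊)^{2𝓅₊}` — `M_k` grows like `k²`, see the header's HONEST SCOPE (ii)),
and (b) that family contains EVERY actual datum of scale `k` on every two-dimensional torus of block size `L`.
[cite: BalabanImbrieJaffe1985, (7.3.1)–(7.3.2) p.326] -/
theorem claim73_second_closed_allTori_two {L : ℕ} (hL : Odd L ∧ 1 < L) {a : ℝ} (ha : 0 < a) (a₀ : ℝ) (ha₀ : 0 < a₀) (pexp : ℝ) :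
    ∃ KR K₀ : ℝ, 1 ≤ KR ∧ 0 ≤ K₀ ∧
      (∀ k : ℕ, ScalarStabData.Claim73 pexp
        (secClosedStabData (d := 2) (KR := KR) (KT := K₀ * k) (pexp := pexp) a₀ ha₀)) ∧
      ∀ (P : Params), P.d = 2 → P.L = L → ∀ (k : ℕ), 1 ≤ k → k ≤ P.m + P.K →
        ∀ (e : ℝ) (he : 0 < e) (he1 : e ≤ 1) (hsmall : e * (1 + Real.log e⁻¹) ^ pexp ≤ 1 / 2) (v : U1Field P k),
          ∃ i : SecClosedIdx 2 KR (K₀ * k) pexp, i.P = P ∧ i.k = k ∧ i.e = e ∧ HEq i.v v := by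
  obtain ⟨KR, K₀, hKR, hK₀, h⟩ := secClosedIdx_allTori_two hL ha pexp
  exact ⟨KR, K₀, hKR, hK₀, fun k => claim73_second_closed a₀ ha₀ KR (K₀ * k) pexp, h⟩

/-! ## §3  The substitution error between the two printed forms on every two-dimensional torus -/

/-- **`‖u_k(c) − v_c‖ ≤ e_k·K₀·k·(π/2)𝓅(e_k)` ON EVERY TWO-DIMENSIONAL TORUS UNDER (7.3.1)** — the defect of substituting `v_b` for `u_k(b)`
(the actual background (4.5.4) computed from `v` with the operators of record) along every unit bond: for every odd `L > 1` ONE `K₀ ≥ 0`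
serves all tori with `P.d = 2`, `P.L = L`, all scales `k ≤ m + K`, all `e > 0`, all exponents `𝓅` and all `v` with
`|v(∂p) − 1| ≤ e𝓅(e)`; neither `e𝓅(e) ≤ ½` nor closedness of `f^{(k)}` is needed (the gen-9 line-sum bound holds for all `g`).
[cite: BalabanImbrieJaffe1985, (7.3.1)–(7.3.2) p.326] -/
theorem norm_lineIter_actualBgU1_sub_vK_le_two {L : ℕ} (hL : Odd L ∧ 1 < L) :
    ∃ K₀ : ℝ, 0 ≤ K₀ ∧ ∀ (P : Params) (hPd : P.d = 2), P.L = L → ∀ (k : ℕ) (hk : k ≤ P.m + P.K) (e : ℝ), 0 < e →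
      ∀ (pexp : ℝ) (v : U1Field P k),
        (∀ p, ‖((plaq v p : Circle) : ℂ) - 1‖ ≤ e * (1 + Real.log e⁻¹) ^ pexp) →
        ∀ c : PBond P (0 + k),
          ‖toC (lineIter (actualBgU1 hPd.ge k e v) k c) - toC (vK k v c)‖ ≤
            e * (K₀ * k * (Real.pi / 2 * (1 + Real.log e⁻¹) ^ pexp)) := by
  obtain ⟨K₀, hK₀, hT⟩ := exists_KT_linear_allTori hL
  refine ⟨K₀, hK₀, fun P hPd hPL k hk e he pexp v h c => ?_⟩
  have hf := abs_plaqField_le_of_hyp he v h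
  have hT' := hT P hPd hPL hPd.ge k hk (plaqField e v) _ hf c
  have h1 := norm_toC_lineIter_actualBgU1_sub_le hPd.ge hk e v c
  rw [abs_of_pos he] at h1
  calc ‖toC (lineIter (actualBgU1 hPd.ge k e v) k c) - toC (vK k v c)‖
      ≤ e * P.eta k * |lineSumIter (TkF P hPd.ge ((P.eta k) ^ P.d) (P.eta k) k (plaqField e v)) k c| := h1
    _ = e * (P.eta k * |lineSumIter (TkF P hPd.ge ((P.eta k) ^ P.d) (P.eta k) k (plaqField e v)) k c|) := by ring
    _ ≤ e * (K₀ * k * (Real.pi / 2 * (1 + Real.log e⁻¹) ^ pexp)) := mul_le_mul_of_nonneg_left hT' he.le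

end

end Literature.MathematicalPhysics.QuantumFieldTheory.BalabanImbrieJaffe1984to88.BIJ85SecClosedIdxAllToriTwo
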